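import Literature.Geometry.Lorentzian.KerrSchildMultiplierCurrent
import Literature.Geometry.Lorentzian.MinkowskiRadialMultiplier
import Literature.Geometry.Lorentzian.KerrSchildHomogeneity

/-!
# Route ClusterCompleteness — crux `AdiabaticMultiKerrILED`: Euler / null-dust zone pumping identity

Helper file for the crux `stmt-FinalStateConjecture-14310` (line `Sketch`, lead c6 wave 1, card
milne-hubble-current): in the rest frame of one hole (spin `a = 0`, mass `M`, centre at the origin)
the crux background is `G = η − F` with `F^{μν}(y) = χ(r) · 2H · ℓ♯^μ ℓ♯^ν`, `r = Kerr.radius 0 y`,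
`H = Kerr.scalarH M 0 y = M / r`, `ℓ♯ = Kerr.nullVector 0 y`, `χ(r) = Real.smoothTransition (2 − r/(8M))`.
Under the dilation `y ↦ t y` (`t > 0`) the radius is homogeneous of degree `1`, `H` of degree `−1` and
`ℓ♯` of degree `0` (`Kerr.radius_smul`, `Kerr.scalarH_smul`, `Kerr.nullVector_dilate`), so Euler's
identity gives the homothety derivative `(y·∂)F^{μν} = (r χ'(r) − χ(r)) · 2H · ℓ♯^μ ℓ♯^ν`
(`fderiv_self_cruxZoneTerm_schwarzschild`); and `χ − r χ' ≥ 0` because the cut-off is non-increasing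
in `r` for `M > 0` (`cruxCutoff_sub_mul_deriv_nonneg`). [folklore]
-/

noncomputable section

-- the doubled `FinalStateConjecture.FinalStateConjecture` path component trips dupNamespace
set_option linter.dupNamespace false

open scoped BigOperators Topology
open Filter Literature.Geometry.Lorentzian

namespace Summit.FinalStateConjecture.FinalStateConjecture.Theorems

/-- **Euler's identity along a ray, abstract form.** If `F : ℝ⁴ → ℝ` is differentiable at `x` and
its restriction to the open ray `t ↦ t • x` (`t > 0`) agrees with a one-variable function `φ` having
derivative `d` at `t = 1`, then the radial derivative `dF(x)[x]` equals `d` (chain rule along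
`t ↦ t • x` and uniqueness of the derivative). [folklore] -/
theorem zonePumping_fderiv_self_eq_of_hasDerivAt {F : E4 → ℝ} {x : E4} {φ : ℝ → ℝ} {d : ℝ}
    (hF : DifferentiableAt ℝ F x) (hφ : HasDerivAt φ d 1)
    (h : ∀ t : ℝ, 0 < t → F (t • x) = φ t) : fderiv ℝ F x x = d := by
  have hline : HasDerivAt (fun t : ℝ ↦ t • x) x 1 :=
    ((hasDerivAt_id' (x := (1 : ℝ))).smul_const x).congr_deriv (one_smul ℝ x)
  have h1 : HasDerivAt (fun t : ℝ ↦ F (t • x)) (fderiv ℝ F x x) 1 :=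
    hF.hasFDerivAt.comp_hasDerivAt_of_eq 1 hline (one_smul ℝ x).symm
  have h2 : HasDerivAt (fun t : ℝ ↦ F (t • x)) d 1 := by
    refine hφ.congr_of_eventuallyEq ?_
    filter_upwards [lt_mem_nhds one_pos] with t ht
    exact h t ht
  exact h1.unique h2

/-- One-variable calculus behind Euler's identity for a degree-`(−1)` profile with a radial
cut-off: for differentiable `χ` and constants `r, C`,
`d/dt|_{t=1} (χ(t r) · t⁻¹ · C) = (r χ'(r) − χ(r)) · C`. [folklore] -/
theorem zonePumping_hasDerivAt_profile {χ : ℝ → ℝ} (hχ : Differentiable ℝ χ) (r C : ℝ) :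
    HasDerivAt (fun t : ℝ ↦ χ (t * r) * t⁻¹ * C) ((r * deriv χ r - χ r) * C) 1 := by
  have h1 : HasDerivAt (fun t : ℝ ↦ χ (t * r)) (deriv χ r * r) 1 :=
    (hχ r).hasDerivAt.comp_of_eq 1 (hasDerivAt_mul_const r) (one_mul r).symm
  have h2 : HasDerivAt (fun t : ℝ ↦ t⁻¹) (-(1 ^ 2)⁻¹) (1 : ℝ) := hasDerivAt_inv one_ne_zero
  refine ((h1.mul h2).mul_const C).congr_deriv ?_
  rw [one_mul, one_pow, inv_one]
  ring

/-- The radial cut-off `s ↦ χ(s) = Real.smoothTransition (2 − s/(8M))` of the crux background is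
differentiable (Mathlib: `Real.smoothTransition` is `C^∞`). [folklore] -/
theorem zonePumping_differentiable_cutoff (M : ℝ) :
    Differentiable ℝ (fun s : ℝ ↦ Real.smoothTransition (2 - s / (8 * M))) :=
  ((Real.smoothTransition.contDiff (n := 1)).differentiable one_ne_zero).comp
    ((differentiable_const 2).sub (differentiable_id.div_const (8 * M)))

/-- **Scaling of the crux zone term along a ray** (`a = 0`): for `t > 0`,
`F^{μν}(t x) = χ(t r) · t⁻¹ · (2H(x) ℓ♯^μ(x) ℓ♯^ν(x))`, `r = Kerr.radius 0 x`, by the degree-`1`,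
`−1`, `0` homogeneity of `r`, `H`, `ℓ♯` (`Kerr.radius_smul`, `Kerr.scalarH_smul`,
`Kerr.nullVector_dilate`; Kerr–Schild 1965, §2). [folklore] -/
theorem zonePumping_cruxZoneTerm_smul (M : ℝ) (x : E4) (μ ν : Fin 4) {t : ℝ} (ht : 0 < t) :
    Real.smoothTransition (2 - Kerr.radius 0 (t • x) / (8 * M)) *
        (2 * Kerr.scalarH M 0 (t • x)) * (Kerr.nullVector 0 (t • x)) μ *
          (Kerr.nullVector 0 (t • x)) ν =
      Real.smoothTransition (2 - t * Kerr.radius 0 x / (8 * M)) * t⁻¹ *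
        (2 * Kerr.scalarH M 0 x * (Kerr.nullVector 0 x) μ * (Kerr.nullVector 0 x) ν) := by
  have hr : Kerr.radius 0 (t • x) = t * Kerr.radius 0 x := by
    simpa using Kerr.radius_smul ht 0 x
  have hl : Kerr.nullVector 0 (t • x) = Kerr.nullVector 0 x := by
    simpa using Kerr.nullVector_dilate ht 0 x
  have hH : Kerr.scalarH M 0 (t • x) = t⁻¹ * Kerr.scalarH M 0 x := by
    have h1 := Kerr.scalarH_smul ht M 0 x
    rw [mul_zero] at h1
    rw [Kerr.scalarH_eq_mul_scalarH_one M 0 (t • x), ← h1]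
    field_simp
  rw [hr, hl, hH]
  ring

/-- **Euler / null-dust zone pumping identity** (`a = 0`). For the crux zone term
`F^{μν}(y) = χ(r) · 2H · ℓ♯^μ ℓ♯^ν` (`r = Kerr.radius 0 y = ‖y⃗‖`, `H = M/r`, `ℓ♯ = Kerr.nullVector 0 y`,
`χ(r) = Real.smoothTransition (2 − r/(8M))`) the homothety derivative at a point off the axis
`{y⃗ = 0}` is `dF^{μν}(x)[x] = (r χ'(r) − χ(r)) · 2H · ℓ♯^μ ℓ♯^ν`: `r`, `H`, `ℓ♯` are homogeneous of
degrees `1`, `−1`, `0` under `y ↦ t y`, and `F` is differentiable at `x` since `r > 0` there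
(Kerr–Schild 1965, §2; Euler's identity). [folklore] -/
theorem fderiv_self_cruxZoneTerm_schwarzschild :
    ∀ (M : ℝ) (x : E4) (hx : 0 < E4.spatialNorm x) (μ ν : Fin 4),
      fderiv ℝ (fun y ↦ Real.smoothTransition (2 - Kerr.radius 0 y / (8 * M)) *
        (2 * Kerr.scalarH M 0 y) * (Kerr.nullVector 0 y) μ * (Kerr.nullVector 0 y) ν) x x =
      (Kerr.radius 0 x * deriv (fun s ↦ Real.smoothTransition (2 - s / (8 * M))) (Kerr.radius 0 x) -
          Real.smoothTransition (2 - Kerr.radius 0 x / (8 * M))) *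
        (2 * Kerr.scalarH M 0 x) * (Kerr.nullVector 0 x) μ * (Kerr.nullVector 0 x) ν := by
  intro M x hx μ ν
  have hx0 : 0 < Kerr.radius 0 x := by rwa [Kerr.radius_zero_left]
  have hχ := zonePumping_differentiable_cutoff M
  -- differentiability of the zone term at `x` (`r > 0` there)
  have hrd : DifferentiableAt ℝ (Kerr.radius 0) x :=
    (Kerr.contDiffAt_radius hx0 (n := 1)).differentiableAt one_ne_zero
  have hHd : DifferentiableAt ℝ (Kerr.scalarH M 0) x :=
    (Kerr.contDiffAt_scalarH M 0 hx0 (n := 1)).differentiableAt one_ne_zero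
  have hld : ∀ κ : Fin 4, DifferentiableAt ℝ (fun y ↦ Kerr.nullVector 0 y κ) x := fun κ ↦
    ((contDiffAt_euclidean.1 (Kerr.contDiffAt_nullVector 0 hx0 (n := 1))) κ).differentiableAt
      one_ne_zero
  have hχd : DifferentiableAt ℝ
      (fun y ↦ Real.smoothTransition (2 - Kerr.radius 0 y / (8 * M))) x :=
    (hχ (Kerr.radius 0 x)).comp x hrd
  have hF : DifferentiableAt ℝ (fun y ↦ Real.smoothTransition (2 - Kerr.radius 0 y / (8 * M)) *
      (2 * Kerr.scalarH M 0 y) * (Kerr.nullVector 0 y) μ * (Kerr.nullVector 0 y) ν) x :=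
    ((hχd.mul (hHd.const_mul 2)).mul (hld μ)).mul (hld ν)
  -- Euler's identity along the ray `t ↦ t • x`
  have key := zonePumping_fderiv_self_eq_of_hasDerivAt hF
    (zonePumping_hasDerivAt_profile hχ (Kerr.radius 0 x)
      (2 * Kerr.scalarH M 0 x * (Kerr.nullVector 0 x) μ * (Kerr.nullVector 0 x) ν))
    (fun t ht ↦ zonePumping_cruxZoneTerm_smul M x μ ν ht)
  rw [key]
  ring

/-- **Sign of the pumping coefficient.** For `M > 0` and `r ≥ 0` the radial cut-off
`χ(r) = Real.smoothTransition (2 − r/(8M))` satisfies `χ(r) − r χ'(r) ≥ 0`: `χ ≥ 0`, and `χ` is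
non-increasing in `r` (`Real.smoothTransition` is monotone and `r ↦ 2 − r/(8M)` is non-increasing for
`M > 0`), so `χ' ≤ 0` and `−r χ'(r) ≥ 0` for `r ≥ 0`. [folklore] -/
theorem cruxCutoff_sub_mul_deriv_nonneg :
    ∀ (M : ℝ) (hM : 0 < M) (r : ℝ) (hr : 0 ≤ r), 0 ≤ Real.smoothTransition (2 - r / (8 * M)) -
      r * deriv (fun s ↦ Real.smoothTransition (2 - s / (8 * M))) r := by
  intro M hM r hr
  have h8 : 0 ≤ 8 * M := (mul_pos (by norm_num) hM).le
  have hanti : Antitone (fun s : ℝ ↦ Real.smoothTransition (2 - s / (8 * M))) := by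
    intro s₁ s₂ h
    have h' : s₁ / (8 * M) ≤ s₂ / (8 * M) := div_le_div_of_nonneg_right h h8
    exact Real.smoothTransition.monotone (by linarith)
  have h1 : deriv (fun s : ℝ ↦ Real.smoothTransition (2 - s / (8 * M))) r ≤ 0 :=
    hanti.deriv_nonpos
  have h2 : 0 ≤ Real.smoothTransition (2 - r / (8 * M)) := Real.smoothTransition.nonneg _
  linarith [mul_nonpos_of_nonneg_of_nonpos hr h1]

end Summit.FinalStateConjecture.FinalStateConjecture.Theorems
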